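import Mathlib

/-!
# The invariant subalgebra of a graded automorphism is graded (B1″ of chain w45c)

(crux stmt-ResolutionOfSingularities-15640 `WildQuotients.WildQuotientResolution`, line `Sketch`,
sub-line T2; [OURS · L1 W4.5c] — NOT a statement of any manuscript.)

For a `k`-algebra `U` graded by a monoid `ι` (Mathlib `GradedAlgebra 𝒰`) and a GRADED `k`-algebra
automorphism `σ` (`σ (𝒰 i) ⊆ 𝒰 i` for all `i`), the homogeneous components of a `σ`-invariant
element are `σ`-invariant (`decompose_mem_fixedPoints_zpowers`), so the invariant subalgebra
`U^⟨σ⟩ = FixedPoints.subalgebra k U (Subgroup.zpowers σ)` is graded by the pieces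
`𝒰 i ∩ U^⟨σ⟩` (`exists_gradedAlgebra_fixedPoints_zpowers`; in particular its degree-`0` piece is
`(U₀)^σ`). This is the input shape of the diagonalizable Bergh–Rydh transfer
(`BerghRydh2019_diagonalizableQuotientResolution`: étale charts `Spec S₀` with `S` regular
graded): with `S = U^⟨σ⟩` regular by `TameTransfer.isRegularRing_fixedPoints_zpowers`.
Only Mathlib is used.
-/

-- single-problem summit: the doubled namespace component `ResolutionOfSingularities` is forced
set_option linter.dupNamespace false

noncomputable section

open DirectSum

namespace Summit.ResolutionOfSingularities.ResolutionOfSingularities.Theorems.WildQuotientResolution.TameTransfer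

variable {ι k U : Type*} [DecidableEq ι] [AddMonoid ι] [Field k] [CommRing U] [Algebra k U]

/-- Membership in the invariant subalgebra of the cyclic group `⟨σ⟩`: `u` is invariant iff
`σ u = u`. [folklore] -/
theorem mem_fixedPoints_zpowers_iff_apply_eq (σ : U ≃ₐ[k] U) (u : U) :
    u ∈ FixedPoints.subalgebra k U (Subgroup.zpowers σ) ↔ σ u = u := by
  change (∀ g : Subgroup.zpowers σ, g • u = u) ↔ σ u = u
  constructor
  · intro h
    exact h ⟨σ, Subgroup.mem_zpowers σ⟩
  · intro h g
    have hst : (g : U ≃ₐ[k] U) ∈ MulAction.stabilizer (U ≃ₐ[k] U) u :=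
      (Subgroup.zpowers_le.mpr (MulAction.mem_stabilizer_iff.mpr h)) g.2
    exact MulAction.mem_stabilizer_iff.mp hst

/-- **Homogeneous components of an invariant are invariant.** For a grading `𝒰` of the
`k`-algebra `U` and a graded `k`-algebra automorphism `σ` (`σ (𝒰 i) ⊆ 𝒰 i`), if `u ∈ U^⟨σ⟩` then
every homogeneous component `uᵢ` lies in `U^⟨σ⟩`: `σ` is a graded ring homomorphism, so
`σ uᵢ = (σ u)ᵢ = uᵢ` (Mathlib `GradedRingHom.map_directSumDecompose`). [folklore] -/
theorem decompose_mem_fixedPoints_zpowers (𝒰 : ι → Submodule k U) [GradedAlgebra 𝒰]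
    (σ : U ≃ₐ[k] U) (hσ : ∀ (i : ι) (u : U), u ∈ 𝒰 i → σ u ∈ 𝒰 i) {u : U}
    (hu : u ∈ FixedPoints.subalgebra k U (Subgroup.zpowers σ)) (i : ι) :
    (decompose 𝒰 u i : U) ∈ FixedPoints.subalgebra k U (Subgroup.zpowers σ) := by
  rw [mem_fixedPoints_zpowers_iff_apply_eq] at hu ⊢
  -- `σ` as a graded ring homomorphism `𝒰 →+*ᵍ 𝒰`
  let f : 𝒰 →+*ᵍ 𝒰 := ⟨(σ : U →+* U), fun {i} {x} hx => hσ i x hx⟩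
  have hf : ∀ x : U, f x = σ x := fun _ => rfl
  rw [← hf, GradedRingHom.map_directSumDecompose, hf, hu]

/-- **The invariant subalgebra of a graded automorphism is graded** (B1″): for a grading `𝒰` of
the `k`-algebra `U` by a monoid `ι` and a graded `k`-algebra automorphism `σ`, there is a
`GradedAlgebra` structure on `U^⟨σ⟩ = FixedPoints.subalgebra k U (Subgroup.zpowers σ)` whose `i`-th
piece consists of the invariants lying in `𝒰 i` (so the degree-`0` piece is `(U₀)^σ`). The pieces
form a graded monoid because `𝒰` does; they are independent because `𝒰` is and `U^⟨σ⟩ ↪ U` is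
injective; they span because the homogeneous components of an invariant are invariant
(`decompose_mem_fixedPoints_zpowers`); the decomposition is then `DirectSum.IsInternal.gradedAlgebra`.
[folklore] -/
theorem exists_gradedAlgebra_fixedPoints_zpowers (𝒰 : ι → Submodule k U) [GradedAlgebra 𝒰]
    (σ : U ≃ₐ[k] U) (hσ : ∀ (i : ι) (u : U), u ∈ 𝒰 i → σ u ∈ 𝒰 i) :
    ∃ (𝒮 : ι → Submodule k (FixedPoints.subalgebra k U (Subgroup.zpowers σ)))
      (_ : GradedAlgebra 𝒮),
      ∀ (i : ι) (s : FixedPoints.subalgebra k U (Subgroup.zpowers σ)), s ∈ 𝒮 i ↔ (s : U) ∈ 𝒰 i := by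
  classical
  set S := FixedPoints.subalgebra k U (Subgroup.zpowers σ) with hS
  -- the pieces: invariants of degree `i`
  let 𝒮 : ι → Submodule k S := fun i => (𝒰 i).comap S.val.toLinearMap
  have hmem : ∀ (i : ι) (s : S), s ∈ 𝒮 i ↔ (s : U) ∈ 𝒰 i := fun i s => Iff.rfl
  -- graded monoid
  haveI : SetLike.GradedMonoid 𝒮 :=
    { one_mem := (hmem 0 1).mpr (SetLike.one_mem_graded 𝒰)
      mul_mem := fun {i j} a b ha hb =>
        (hmem (i + j) (a * b)).mpr (SetLike.mul_mem_graded ((hmem i a).mp ha) ((hmem j b).mp hb)) }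
  -- independence, from that of `𝒰` along the injection `S ↪ U`
  have hind : iSupIndep 𝒮 := by
    have h𝒰 : iSupIndep 𝒰 := (Decomposition.isInternal 𝒰).submodule_iSupIndep
    intro i
    have hle : (⨆ j ≠ i, 𝒮 j) ≤ (⨆ j ≠ i, 𝒰 j).comap S.val.toLinearMap := by
      refine iSup₂_le fun j hj => ?_
      exact Submodule.comap_mono (le_iSup₂ (f := fun j _ => 𝒰 j) j hj)
    rw [disjoint_iff_inf_le]
    intro s hs
    have h1 : (s : U) ∈ 𝒰 i := (hmem i s).mp hs.1
    have h2 : (s : U) ∈ ⨆ j ≠ i, 𝒰 j := hle hs.2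
    have h0 : (s : U) = 0 := by
      have := (h𝒰 i).le_bot (Submodule.mem_inf.mpr ⟨h1, h2⟩)
      simpa using this
    rw [Submodule.mem_bot]
    exact Subtype.ext h0
  -- the pieces span: homogeneous components of invariants are invariant
  have htop : ⨆ i, 𝒮 i = ⊤ := by
    rw [eq_top_iff]
    rintro s -
    have hcomp : ∀ i, (decompose 𝒰 (s : U) i : U) ∈ S := fun i =>
      decompose_mem_fixedPoints_zpowers 𝒰 σ hσ s.2 i
    have hsum : s = ∑ i ∈ (decompose 𝒰 (s : U)).support, (⟨_, hcomp i⟩ : S) := by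
      apply Subtype.ext
      rw [AddSubmonoidClass.coe_finsetSum]
      exact (sum_support_decompose 𝒰 (s : U)).symm
    rw [hsum]
    exact Submodule.sum_mem _ fun i _ =>
      Submodule.mem_iSup_of_mem i ((hmem i _).mpr (decompose 𝒰 (s : U) i).2)
  have hint : IsInternal 𝒮 :=
    (isInternal_submodule_iff_iSupIndep_and_iSup_eq_top 𝒮).mpr ⟨hind, htop⟩
  exact ⟨𝒮, hint.gradedAlgebra, hmem⟩

end Summit.ResolutionOfSingularities.ResolutionOfSingularities.Theorems.WildQuotientResolution.TameTransfer

end
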